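import Literature.NumberTheory.Automorphic.WeaklyRegularGaloisRep
import HarnessLib

/-!
# Irreducibility of the Galois representations of a polarizable regular algebraic cuspidal
# representation at a positive density of primes (Patrikis–Taylor 2015, Thm. 1.7) — the "one
# good prime" form

Topic `Literature/NumberTheory/Automorphic`; companion of `WeaklyRegularGaloisRep.lean`
(`FakhruddinPilloni2021_galoisRep_of_weaklyRegular_normTwist`: the same pairing form
`IsEssConjSelfDual π χ`, `χ = ‖·‖_𝔸^m`, and the same attachment clause
`arithFrobPolyOfSatake ι q_v n β` — the C-normalisation `rec(π_v |det|_v^{(1-n)/2})`) and of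
`ReciprocityGLn.lean`.  Requested by cite item wi-38104: the typed named fact
`PatrikisTaylorGoodPrime` of the region skeleton `prime-rank-transport` of crux
`IrreducibleOffSector` (route `Langlands/IrreducibilityBySelfDuality`), whose consumer is
`regionB_of`; the body below is VERBATIM that Prop with its two abbreviations (`IsAttached`,
`IsPolarizedNorm`) unfolded, so the skeleton's fact is this one by `exact h`.

## Source and what is printed (held text `paper:arxiv-1307.1640`)

S. Patrikis, R. Taylor, *Automorphy and irreducibility of some `l`-adic representations*,
Compositio Math. 151 (2015) 207–229 = arXiv:1307.1640 [PatrikisTaylor2014].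

* §1, p. 7 (the attached compatible system): "Suppose that `F` is a number field and that `π` is
  a regular algebraic cuspidal automorphic representation of `GL_n(𝔸_F)` … We let `S_π` denote the
  set of primes of `F` where `π` is ramified and for `v ∉ S_π` … `Q_{π,v}(X) ∈ M_π[X]` denote the
  characteristic polynomial of `rec_{F_v}(π_v |det|_v^{(1-n)/2})`. … In the case that `F` is a CM
  field and `π` is polarizable, it is known that for each prime `λ` of `M_π` there is a continuous
  semi-simple representation `r_{π,λ} : G_F → GL_n(M̄_{π,λ})` such that
  `𝓡_π = (M_π, S_π, {Q_{π,v}(X)}, {r_{π,λ}}, {H_τ})` is a regular, strictly pure compatible system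
  of `l`-adic representations. (Combine theorem 2.1.1 of [BLGGT], theorem 1.1 of [Caraiani] and
  the usual twisting and descent arguments …)" — i.e. `r_{π,λ}` is unramified outside `S_π ∪ {v ∣ l}`
  with `charpoly r_{π,λ}(Frob_v) = Q_{π,v}` ([BLGGT] §5.1, definition of a weakly compatible system).
* **Theorem 1.7** (p. 8): "Suppose that `F` is a CM field and that `π` is a polarizable, regular
  algebraic, cuspidal automorphic representation of `GL_n(𝔸_F)`. Then there is a finite CM
  extension `M/M_π` and a Dirichlet density `1` set `𝓛` of rational primes, such that for all
  conjugation-invariant primes `λ` of `M` dividing an `ℓ ∈ 𝓛`, `r_{π,λ|_{M_π}}` is irreducible.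
  In particular, there is a positive Dirichlet density set `𝓛′` of rational primes such that if a
  prime `λ` of `M_π` divides some `ℓ ∈ 𝓛′`, then `r_{π,λ}` is irreducible." ("The proof is the
  same as the proof of theorem 5.5.2 and proposition 5.4.6 of [BLGGT], except that instead of
  appealing to lemma 5.4.5 of [BLGGT] one appeals to lemma 1.6 above.")
* "Polarizable" ([BLGGT] §2.1, the standing reference of the source): there is a continuous
  character `χ : 𝔸_{F⁺}^×/(F⁺)^× → ℂ^×` with `χ_v(-1) = (-1)^n` for all `v ∣ ∞` and
  `π^c ≅ π^∨ ⊗ (χ ∘ N_{F/F⁺} ∘ det)`.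

## Rendering and faithfulness

* `K` CM: Mathlib's `NumberField.IsCMField K`; `π : CuspidalAutomorphicRepData n K hcpt` regular
  algebraic (`IsRegularAlgebraic`, Clozel); `0 < n`.
* POLARIZED UP TO A NORM POWER: `∃ χ m, (∀ x, χ x = ‖x‖^m) ∧ π.1.IsEssConjSelfDual χ` — the tree's
  accepted pairing form of `π^c ≅ π^∨ ⊗ (χ ∘ det)` (`EssConjSelfDual.lean`) with `χ = ‖·‖_{𝔸_K}^m`,
  exactly the specialisation used by the accepted
  `FakhruddinPilloni2021_galoisRep_of_weaklyRegular_normTwist`.  Such `π` ARE polarizable in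
  [BLGGT]'s sense: `‖·‖_{𝔸_K}^m = ‖·‖_{𝔸_{K⁺}}^m ∘ N_{K/K⁺}`, and the sign condition is met by
  `χ₀ = ‖·‖^m · ε_{K/K⁺}^n` (`ε_{K/K⁺}` is trivial on norms and `ε_{K/K⁺,v}(-1) = -1` at every real
  `v`, `K/K⁺` being totally imaginary).  So the hypothesis is a SPECIAL CASE of the printed one
  (the fact is weaker than print, never stronger).
* ATTACHED at `(ℓ, ι)`: `r : Γ_K → GL_n(ℚ̄_ℓ)` (`FramedGaloisRep`) semisimple (printed: "continuous
  semi-simple representation") and, at every finite `v ∤ ℓ` where `π` has a Satake parameter `β`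
  (`HasSatakeParamAt`, i.e. `π_v` unramified, `v ∉ S_π`), unramified with arithmetic-Frobenius
  characteristic polynomial `arithFrobPolyOfSatake ι q_v n β` — the tree's rendering of
  `ı(Q_{π,v}) = charpoly rec(π_v |det|_v^{(1-n)/2})(Frob_v)` through `ι : ℚ̄_ℓ ≃ ℂ`, verbatim the
  clause of `FakhruddinPilloni2021_galoisRep_of_weaklyRegular_normTwist` and of the crux's binder
  `H4att'`.  The fact BUNDLES the existence of such an `r` (p. 7: [BLGGT] Thm. 2.1.1, Caraiani)
  with Theorem 1.7, at ONE prime: "for a positive density of `ℓ`, `r_{π,λ}` is irreducible for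
  every `λ ∣ ℓ`" is weakened to "at SOME `(ℓ₀, ι₀)` some attached `r₀` is irreducible" (for such
  `ℓ₀ ∈ 𝓛′` and any `ι₀`, the place `λ` of `M_π` under `ι₀⁻¹` divides `ℓ₀`, and
  `r₀ = ι₀⁻¹ ∘ r_{π,λ}` is attached and irreducible).  Irreducible = `toGaloisRep.IsIrreducible`
  (over `ℚ̄_ℓ`, = absolutely irreducible).

## References

* [PatrikisTaylor2014] Compositio Math. 151 (2015) 207–229, §1 p. 7 and Thm. 1.7 (p. 8 of
  arXiv:1307.1640), Lemma 1.6.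
* [BarnetlambEtAl2014] T. Barnet-Lamb, T. Gee, D. Geraghty, R. Taylor, Ann. of Math. 179 (2014),
  §2.1 (polarizable; Thm. 2.1.1: existence of `r_{ℓ,ι}(π)`), §5.1 (weakly compatible systems),
  Prop. 5.4.6, Thm. 5.5.2.
* A. Caraiani, Duke Math. J. 161 (2012), Thm. 1.1 (local–global compatibility, purity).
-/

noncomputable section

open scoped NumberField
open NumberField IsDedekindDomain Filter

namespace Literature.NumberTheory.Automorphic

open Literature.NumberTheory.GaloisRepresentations (HeckeCharacter ideleGroup ideleNorm FramedGaloisRep)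

/-- **Patrikis–Taylor 2015, Theorem 1.7 with the existence of the attached representations
(§1 p. 7; [BLGGT] Thm. 2.1.1), in the "one good prime" form.**  Let `K` be a CM number field,
`0 < n`, and `π` a REGULAR ALGEBRAIC cuspidal automorphic representation of `GL_n(𝔸_K)` which is
POLARIZED UP TO A NORM POWER: `π^c ≅ π^∨ ⊗ (χ ∘ det)` in the tree's pairing form
(`IsEssConjSelfDual π χ`) for the Hecke character `χ = ‖·‖_𝔸^m`, some `m ∈ ℤ` (hence polarizable in
the sense of [BLGGT] §2.1, module docstring).  Then at SOME prime `ℓ₀` and SOME `ι₀ : ℚ̄_{ℓ₀} ≃ ℂ`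
there is a continuous `r₀ : Γ_K → GL_n(ℚ̄_{ℓ₀})` ATTACHED to `(π, ι₀)` — semisimple, and at every
finite `v ∤ ℓ₀` where `π` has Satake parameter `β` unramified with arithmetic-Frobenius
characteristic polynomial `arithFrobPolyOfSatake ι₀ q_v n β` (printed `Q_{π,v} = charpoly
rec(π_v |det|_v^{(1-n)/2})`) — which is IRREDUCIBLE.  Printed: "there is a positive Dirichlet
density set `𝓛′` of rational primes such that if a prime `λ` of `M_π` divides some `ℓ ∈ 𝓛′`,
then `r_{π,λ}` is irreducible"; the typed form keeps one such `(ℓ₀, ι₀)` (weaker than print) and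
bundles the existence of the attached system (p. 7).  VERBATIM the region-skeleton Prop
`PatrikisTaylorGoodPrime` of crux `IrreducibleOffSector` with `IsAttached` / `IsPolarizedNorm`
unfolded.  Named fact (D-0014); users take `(h : PatrikisTaylor2014_theorem1_7_goodPrime)`.
[cite: PatrikisTaylor2014, Thm. 1.7 (p. 8 of arXiv:1307.1640) and §1 p. 7 (the attached system)]
[cite: BarnetlambEtAl2014, Thm. 2.1.1 and §2.1 (polarizable), §5.1] -/
def PatrikisTaylor2014_theorem1_7_goodPrime : Prop :=
  ∀ (n : ℕ), 0 < n → ∀ (K : Type) [Field K] [NumberField K] [IsCMField K]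
    (hcpt : isCompact_glFiniteIntegralLevel n K) (π : CuspidalAutomorphicRepData n K hcpt),
      π.1.IsRegularAlgebraic →
      (∃ (χ : HeckeCharacter K) (m : ℤ),
          (∀ x : ideleGroup K, ((χ x : ℂˣ) : ℂ) = (ideleNorm x : ℂ) ^ (m : ℂ)) ∧
            π.1.IsEssConjSelfDual χ) →
        ∃ (ℓ₀ : ℕ) (_ : Fact ℓ₀.Prime) (ι₀ : PadicAlgCl ℓ₀ ≃+* ℂ)
          (r₀ : FramedGaloisRep K (PadicAlgCl ℓ₀) n),
          (r₀.toGaloisRep.IsSemisimple ∧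
            ∀ (v : HeightOneSpectrum (𝓞 K)) (β : Multiset ℂ), π.1.HasSatakeParamAt v β →
              ((ℓ₀ : ℕ) : 𝓞 K) ∉ v.asIdeal →
                r₀.IsUnramifiedAt v ∧
                  r₀.HasFrobCharpolyAt v (arithFrobPolyOfSatake ι₀ v.residueCard n β)) ∧
          r₀.toGaloisRep.IsIrreducible

/-- Hypothesis form: given the fact, a regular algebraic, norm-polarized cuspidal `π` on `GL_n/K`,
`K` CM, has an irreducible attached `ℓ₀`-adic representation at some `(ℓ₀, ι₀)`.
[cite: PatrikisTaylor2014, Thm. 1.7] -/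
theorem PatrikisTaylor2014_theorem1_7_goodPrime.apply (h : PatrikisTaylor2014_theorem1_7_goodPrime)
    {n : ℕ} (hn : 0 < n) {K : Type} [Field K] [NumberField K] [IsCMField K]
    {hcpt : isCompact_glFiniteIntegralLevel n K} (π : CuspidalAutomorphicRepData n K hcpt)
    (hra : π.1.IsRegularAlgebraic) {χ : HeckeCharacter K} {m : ℤ}
    (hχ : ∀ x : ideleGroup K, ((χ x : ℂˣ) : ℂ) = (ideleNorm x : ℂ) ^ (m : ℂ))
    (hpol : π.1.IsEssConjSelfDual χ) :
    ∃ (ℓ₀ : ℕ) (_ : Fact ℓ₀.Prime) (ι₀ : PadicAlgCl ℓ₀ ≃+* ℂ)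
      (r₀ : FramedGaloisRep K (PadicAlgCl ℓ₀) n),
      (r₀.toGaloisRep.IsSemisimple ∧
        ∀ (v : HeightOneSpectrum (𝓞 K)) (β : Multiset ℂ), π.1.HasSatakeParamAt v β →
          ((ℓ₀ : ℕ) : 𝓞 K) ∉ v.asIdeal →
            r₀.IsUnramifiedAt v ∧
              r₀.HasFrobCharpolyAt v (arithFrobPolyOfSatake ι₀ v.residueCard n β)) ∧
      r₀.toGaloisRep.IsIrreducible :=
  h n hn K hcpt π hra ⟨χ, m, hχ, hpol⟩

end Literature.NumberTheory.Automorphic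

end
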